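import Summits.ValiantsHypothesis.ValiantsHypothesis.Theorems.LacunarySymmetroidMatrixDescartesDoorA26WallBubblingSecondOrderWitnesses

/-!
# `DoorA26` / line `wall_bubbling` — THE DISCRIMINANT FORM of the second-order opening (order ≤ 3): persistence + discriminants ⇒ twenty

HONEST FRAMING.  Object-search cell `pub-symmetroid`, crux `Theses.LacunarySymmetroid.DoorA26` (stmt-ValiantsHypothesis-19979; OPEN, typed,
never asserted).  W2 seat val-sym-door-p1 g20, file #88; def-free helper for obligation (R) of `Cruxes/DoorA26/Lines/wall_bubbling.lean`.
Imports #86 `…SecondOrderWitnesses` (and through it #82 `…SecondOrderOpening`).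

THE THEOREM (`mem_twentyLocus_of_secondOrder_discriminant`).  Symmetric `S, T₁, T₂`; separated points `z_j` of exact orders `m_j ∈ {1,2,3}` for
`F = det P`, `Σ m_j ≥ 20`; persistence of the first variation `c₁ = pol(P,Q₁)` (`c₁(z_j) = 0` at every multiple zero, `c₁′ = 0` at the triple zeros);
with `c₂ = pol(P,Q₂) + det Q₁`: positive discriminant `4·(F″(z_j)/2)·c₂(z_j) < c₁′(z_j)²` at every touch, `c₂(z_j) = 0` and
`3·(F‴(z_j)/6)·((pol(P,Q₂))′(z_j) + (det Q₁)′(z_j)) < (c₁″(z_j)/2)²` at every triple zero — exactly alternative (a) of the level-2 dichotomy #87 — and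
solvability of the value interpolation `pol(P(z_j), Q₃(z_j)) = v_j` at the triple zeros (true for rank-one triple zeros, ≤ 6 of them; taken as a
hypothesis).  Then `δ ∈ TwentyLocus`: the witnesses of #86 and a third shift `T₃` fixing the constants of the cubics feed #82.

WHAT IS HERE.  ★★ `mem_twentyLocus_of_secondOrder_discriminant`.  With #87 this completes LEVEL 2 of the obstruction tower for order ≤ 3 in the kernel:
given persistence data `T₁`, either a `T₂` as above exists (⇒ twenty, this file) or a level-2 certificate exists (#87 (b); for the |J| = 7 core it reads
`Φ(Q₁) ≤ 0`, memo `DOOR-A26-P1G20-NEWTON-LIFT.md` §3.3).  Nothing here bears on `DoorA26`, `DoorA34`, (W)/(M)/(R), `MatrixDescartes` (18050) or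
`VP ≠ VNP`; registers unchanged.

[this work] the assembly.
-/

set_option linter.dupNamespace false

namespace Summit.ValiantsHypothesis.ValiantsHypothesis.Theorems.LacunarySymmetroidMatrixDescartes.WallBubbling

open Finset Filter Topology
open Bubbling (TwentyLocus expSum hasDerivAt_expSum)

/-- ★★ **THE DISCRIMINANT FORM OF THE SECOND-ORDER OPENING** (see the module docstring). [this work] -/
theorem mem_twentyLocus_of_secondOrder_discriminant (δ : Fin 6 → ℝ) (S T₁ T₂ : Fin 6 → Matrix (Fin 2) (Fin 2) ℝ)
    (hS : ∀ l, (S l).IsSymm) (hT₁ : ∀ l, (T₁ l).IsSymm) (hT₂ : ∀ l, (T₂ l).IsSymm)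
    {r : ℕ} (z : Fin r → ℝ) {ρ : ℝ} (hρ : 0 < ρ) (hsep : ∀ i j : Fin r, i < j → z i + ρ ≤ z j - ρ)
    (m : Fin r → ℕ) (hm1 : ∀ j, 1 ≤ m j) (hm3 : ∀ j, m j ≤ 3) (hm : 20 ≤ ∑ j, m j)
    (hvan : ∀ j, ∀ i < m j, iteratedDeriv i (fun t => (∑ l, Real.exp (δ l * t) • S l).det) (z j) = 0)
    (htop : ∀ j, iteratedDeriv (m j) (fun t => (∑ l, Real.exp (δ l * t) • S l).det) (z j) ≠ 0)
    (hc1 : ∀ j, 2 ≤ m j →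
      ((∑ l, Real.exp (δ l * z j) • S l) + (∑ l, Real.exp (δ l * z j) • T₁ l)).det
        - (∑ l, Real.exp (δ l * z j) • S l).det - (∑ l, Real.exp (δ l * z j) • T₁ l).det = 0)
    (hc1' : ∀ j, m j = 3 → deriv (fun t => ((∑ l, Real.exp (δ l * t) • S l) + (∑ l, Real.exp (δ l * t) • T₁ l)).det
        - (∑ l, Real.exp (δ l * t) • S l).det - (∑ l, Real.exp (δ l * t) • T₁ l).det) (z j) = 0)
    (hc2 : ∀ j, m j = 3 →
      (((∑ l, Real.exp (δ l * z j) • S l) + (∑ l, Real.exp (δ l * z j) • T₂ l)).det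
        - (∑ l, Real.exp (δ l * z j) • S l).det - (∑ l, Real.exp (δ l * z j) • T₂ l).det)
        + (∑ l, Real.exp (δ l * z j) • T₁ l).det = 0)
    (hdisc : ∀ j, m j = 2 →
      4 * (iteratedDeriv 2 (fun t => (∑ l, Real.exp (δ l * t) • S l).det) (z j) / 2) *
        ((((∑ l, Real.exp (δ l * z j) • S l) + (∑ l, Real.exp (δ l * z j) • T₂ l)).det
          - (∑ l, Real.exp (δ l * z j) • S l).det - (∑ l, Real.exp (δ l * z j) • T₂ l).det)
          + (∑ l, Real.exp (δ l * z j) • T₁ l).det)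
      < (deriv (fun t => ((∑ l, Real.exp (δ l * t) • S l) + (∑ l, Real.exp (δ l * t) • T₁ l)).det
          - (∑ l, Real.exp (δ l * t) • S l).det - (∑ l, Real.exp (δ l * t) • T₁ l).det) (z j)) ^ 2)
    (hcub : ∀ j, m j = 3 →
      3 * (iteratedDeriv 3 (fun t => (∑ l, Real.exp (δ l * t) • S l).det) (z j) / 6) *
        (deriv (fun t => ((∑ l, Real.exp (δ l * t) • S l) + (∑ l, Real.exp (δ l * t) • T₂ l)).det
            - (∑ l, Real.exp (δ l * t) • S l).det - (∑ l, Real.exp (δ l * t) • T₂ l).det) (z j)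
          + deriv (fun t => (∑ l, Real.exp (δ l * t) • T₁ l).det) (z j))
      < (iteratedDeriv 2 (fun t => ((∑ l, Real.exp (δ l * t) • S l) + (∑ l, Real.exp (δ l * t) • T₁ l)).det
          - (∑ l, Real.exp (δ l * t) • S l).det - (∑ l, Real.exp (δ l * t) • T₁ l).det) (z j) / 2) ^ 2)
    (hT3 : ∀ v : Fin r → ℝ, ∃ T₃ : Fin 6 → Matrix (Fin 2) (Fin 2) ℝ, (∀ l, (T₃ l).IsSymm) ∧
      ∀ j, m j = 3 → ((∑ l, Real.exp (δ l * z j) • S l) + (∑ l, Real.exp (δ l * z j) • T₃ l)).det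
        - (∑ l, Real.exp (δ l * z j) • S l).det - (∑ l, Real.exp (δ l * z j) • T₃ l).det = v j) :
    δ ∈ TwentyLocus := by
  classical
  -- abbreviations
  set P : ℝ → Matrix (Fin 2) (Fin 2) ℝ := fun t => ∑ l, Real.exp (δ l * t) • S l with hP
  set Q₁ : ℝ → Matrix (Fin 2) (Fin 2) ℝ := fun t => ∑ l, Real.exp (δ l * t) • T₁ l with hQ₁
  set Q₂ : ℝ → Matrix (Fin 2) (Fin 2) ℝ := fun t => ∑ l, Real.exp (δ l * t) • T₂ l with hQ₂
  set F : ℝ → ℝ := fun t => (P t).det with hF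
  set c₁ : ℝ → ℝ := fun t => (P t + Q₁ t).det - (P t).det - (Q₁ t).det with hc₁
  set π₂ : ℝ → ℝ := fun t => (P t + Q₂ t).det - (P t).det - (Q₂ t).det with hπ₂
  set d₁ : ℝ → ℝ := fun t => (Q₁ t).det with hd₁
  -- differentiability of the pieces of `c₂ = π₂ + d₁` (all determinants of pencils are exponential sums)
  have hdiffdet : ∀ (U : Fin 6 → Matrix (Fin 2) (Fin 2) ℝ) (t : ℝ), DifferentiableAt ℝ (fun t => (∑ l, Real.exp (δ l * t) • U l).det) t := by
    intro U t
    rw [det_expPencil_eq_expSum_fun δ U]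
    exact (hasDerivAt_expSum _ _ t).differentiableAt
  have hdiffsum : ∀ (U V : Fin 6 → Matrix (Fin 2) (Fin 2) ℝ) (t : ℝ),
      DifferentiableAt ℝ (fun t => ((∑ l, Real.exp (δ l * t) • U l) + (∑ l, Real.exp (δ l * t) • V l)).det) t := by
    intro U V t
    have : (fun t => ((∑ l, Real.exp (δ l * t) • U l) + (∑ l, Real.exp (δ l * t) • V l)).det)
        = fun t => (∑ l, Real.exp (δ l * t) • (U l + V l)).det := funext fun t => by rw [expPencil_add]
    rw [this]; exact hdiffdet _ t
  have hπ₂diff : ∀ t, DifferentiableAt ℝ π₂ t :=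
    fun t => ((hdiffsum S T₂ t).sub (hdiffdet S t)).sub (hdiffdet T₂ t)
  have hd₁diff : ∀ t, DifferentiableAt ℝ d₁ t := fun t => hdiffdet T₁ t
  have hderiv_c₂ : ∀ t, deriv (fun t => π₂ t + d₁ t) t = deriv π₂ t + deriv d₁ t :=
    fun t => deriv_add (hπ₂diff t) (hd₁diff t)
  -- per zero: a constant `e_j` (the cubic's constant term) and `ℕ`-indexed witnesses with signs
  have hwit : ∀ j, ∃ (e : ℝ) (s sg : ℕ → ℝ), (∀ i, i < m j → s i < s (i + 1)) ∧ (∀ i, i ≤ m j → s i ≠ 0) ∧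
      (∀ i, i < m j → sg i * sg (i + 1) < 0) ∧
      ∀ i, i ≤ m j → 0 < sg i *
        (if m j = 1 then deriv F (z j) * s i
         else if m j = 2 then iteratedDeriv 2 F (z j) / 2 * s i ^ 2 + deriv c₁ (z j) * s i + (π₂ (z j) + d₁ (z j))
         else iteratedDeriv 3 F (z j) / 6 * s i ^ 3 + iteratedDeriv 2 c₁ (z j) / 2 * s i ^ 2
              + deriv (fun t => π₂ t + d₁ t) (z j) * s i + e) := by
    intro j
    have h1 := hm1 j; have h3 := hm3 j
    rcases (by omega : m j = 1 ∨ m j = 2 ∨ m j = 3) with h | h | h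
    · -- simple zero: `σ = ∓1`, signs `−F′, F′`
      have hne : deriv F (z j) ≠ 0 := by
        have := htop j; rw [h, iteratedDeriv_one] at this; exact this
      refine ⟨0, fun i => if i = 0 then -1 else 1, fun i => if i = 0 then -deriv F (z j) else deriv F (z j), ?_, ?_, ?_, ?_⟩
      · intro i hi; rw [h] at hi
        have : i = 0 := by omega
        subst this; norm_num
      · intro i _; by_cases hi : i = 0 <;> simp [hi]
      · intro i hi; rw [h] at hi
        have : i = 0 := by omega
        subst this
        have hsq := mul_self_pos.2 hne
        norm_num
        nlinarith
      · intro i hi; rw [h] at hi ⊢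
        simp only [if_true]
        have hsq := mul_self_pos.2 hne
        interval_cases i <;> simp <;> nlinarith
    · -- touch: the quadratic witnesses
      have hA : iteratedDeriv 2 F (z j) / 2 ≠ 0 := by
        have := htop j; rw [h] at this; exact div_ne_zero this two_ne_zero
      have hD : 0 < (deriv c₁ (z j)) ^ 2 - 4 * (iteratedDeriv 2 F (z j) / 2) * (π₂ (z j) + d₁ (z j)) := by
        have := hdisc j h; linarith
      obtain ⟨σ₀, σ₁, σ₂, h01, h12, n0, n1, n2, s0, s1, s2⟩ := quadratic_witnesses hA hD
      refine ⟨0, fun i => if i = 0 then σ₀ else if i = 1 then σ₁ else σ₂,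
        fun i => if i = 0 then iteratedDeriv 2 F (z j) / 2 else if i = 1 then -(iteratedDeriv 2 F (z j) / 2) else iteratedDeriv 2 F (z j) / 2,
        ?_, ?_, ?_, ?_⟩
      · intro i hi; rw [h] at hi
        interval_cases i <;> simp [h01, h12]
      · intro i hi; rw [h] at hi
        interval_cases i <;> simp [n0, n1, n2]
      · intro i hi; rw [h] at hi
        have hsq := mul_self_pos.2 hA
        interval_cases i <;> simp <;> nlinarith
      · intro i hi; rw [h] at hi ⊢
        simp only [show (2 : ℕ) ≠ 1 by norm_num, if_false, if_true]
        interval_cases i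
        · simpa using s0
        · simp only [one_ne_zero, if_false, if_true]; nlinarith [s1]
        · simp only [show (2 : ℕ) ≠ 0 by norm_num, show (2 : ℕ) ≠ 1 by norm_num, if_false]; exact s2
    · -- triple zero: the cubic witnesses (the constant `e₃` is ours to choose)
      have hA : iteratedDeriv 3 F (z j) / 6 ≠ 0 := by
        have := htop j; rw [h] at this; exact div_ne_zero this (by norm_num)
      have hD : 3 * (iteratedDeriv 3 F (z j) / 6) * deriv (fun t => π₂ t + d₁ t) (z j) < (iteratedDeriv 2 c₁ (z j) / 2) ^ 2 := by
        rw [hderiv_c₂]; exact hcub j h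
      obtain ⟨e₃, σ₀, σ₁, σ₂, σ₃, h01, h12, h23, n0, n1, n2, n3, s0, s1, s2, s3⟩ := cubic_witnesses hA hD
      refine ⟨e₃, fun i => if i = 0 then σ₀ else if i = 1 then σ₁ else if i = 2 then σ₂ else σ₃,
        fun i => if i = 0 then -(iteratedDeriv 3 F (z j) / 6) else if i = 1 then iteratedDeriv 3 F (z j) / 6
          else if i = 2 then -(iteratedDeriv 3 F (z j) / 6) else iteratedDeriv 3 F (z j) / 6, ?_, ?_, ?_, ?_⟩
      · intro i hi; rw [h] at hi
        interval_cases i <;> simp [h01, h12, h23]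
      · intro i hi; rw [h] at hi
        interval_cases i <;> simp [n0, n1, n2, n3]
      · intro i hi; rw [h] at hi
        have hsq := mul_self_pos.2 hA
        interval_cases i <;> simp <;> nlinarith
      · intro i hi; rw [h] at hi ⊢
        simp only [show (3 : ℕ) ≠ 1 by norm_num, show (3 : ℕ) ≠ 2 by norm_num, if_false]
        interval_cases i
        · simp only [if_true]; nlinarith [s0]
        · simp only [one_ne_zero, if_false, if_true]; exact s1
        · simp only [show (2 : ℕ) ≠ 0 by norm_num, show (2 : ℕ) ≠ 1 by norm_num, if_false, if_true]; nlinarith [s2]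
        · simp only [show (3 : ℕ) ≠ 0 by norm_num, show (3 : ℕ) ≠ 1 by norm_num, show (3 : ℕ) ≠ 2 by norm_num, if_false]; exact s3
  choose e s sg hsmono hs0 hsgalt hsM using hwit
  -- the third shift fixes the constants of the cubics
  obtain ⟨T₃, hT₃, hT₃v⟩ := hT3 (fun j => e j - ((Q₁ (z j) + Q₂ (z j)).det - (Q₁ (z j)).det - (Q₂ (z j)).det))
  -- feed #82
  refine mem_twentyLocus_of_secondOrder_openings δ S T₁ T₂ T₃ hS hT₁ hT₂ hT₃ z hρ hsep m hm1 hm3 hm hvan hc1 hc1' hc2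
    (fun j i => s j i.val) ?_ ?_ (fun j i => sg j i.val) ?_ ?_
  · intro j
    refine Fin.strictMono_iff_lt_succ.2 fun i => ?_
    show s j i.castSucc.val < s j i.succ.val
    rw [Fin.val_succ, Fin.val_castSucc]
    exact hsmono j i.val i.isLt
  · intro j i
    exact hs0 j i.val (Nat.lt_succ_iff.1 i.isLt)
  · intro j i
    show sg j i.castSucc.val * sg j i.succ.val < 0
    rw [Fin.val_succ, Fin.val_castSucc]
    exact hsgalt j i.val i.isLt
  · intro j i
    have hmain := hsM j i.val (Nat.lt_succ_iff.1 i.isLt)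
    by_cases hj1 : m j = 1
    · rw [if_pos hj1] at hmain ⊢; exact hmain
    · rw [if_neg hj1] at hmain ⊢
      by_cases hj2 : m j = 2
      · rw [if_pos hj2] at hmain ⊢; exact hmain
      · rw [if_neg hj2] at hmain ⊢
        have hj3 : m j = 3 := by have := hm1 j; have := hm3 j; omega
        -- the constant of the cubic is `e j`
        have hconst : (((∑ l, Real.exp (δ l * z j) • S l) + (∑ l, Real.exp (δ l * z j) • T₃ l)).det
            - (∑ l, Real.exp (δ l * z j) • S l).det - (∑ l, Real.exp (δ l * z j) • T₃ l).det)
            + (((∑ l, Real.exp (δ l * z j) • T₁ l) + (∑ l, Real.exp (δ l * z j) • T₂ l)).det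
              - (∑ l, Real.exp (δ l * z j) • T₁ l).det - (∑ l, Real.exp (δ l * z j) • T₂ l).det) = e j := by
          rw [hT₃v j hj3]; simp only [hQ₁, hQ₂]; ring
        rw [hconst]
        exact hmain

end Summit.ValiantsHypothesis.ValiantsHypothesis.Theorems.LacunarySymmetroidMatrixDescartes.WallBubbling
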